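import Literature.NumberTheory.LFunctions.LogIntegralProofs
import HarnessLib

/-!
# Discharge of `Literature.NumberTheory.LFunctions.logIntegral_two_pos`: `li 2 > 0`

D-0014 keeps `Literature/` sorry-free by stating cited results as named facts `def X : Prop`.
This sibling file of `Literature.NumberTheory.LFunctions.LogIntegral` proves the named fact
`Literature.NumberTheory.LFunctions.logIntegral_two_pos` — `0 < logIntegral 2` — as
`theorem logIntegral_two_pos_holds`; users holding `(h : logIntegral_two_pos)` are fed
`logIntegral_two_pos_holds`.

`Literature.NumberTheory.LFunctions.logIntegral` is *defined* by Ramanujan's (Nielsen's) series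
`li x = γ + log (log x) + Σ_{n ≥ 1} (log x)^n / (n · n!)` (Abramowitz–Stegun 5.1.10 at `log x`,
with 5.1.3 `li x = Ei (ln x)`). Numerically `li 2 = 1.04516…` (Abramowitz–Stegun, Table 5.1;
Schoenfeld 1976 works with `li 2 ≈ 1.0452`). The positivity is read off the series with the
two Mathlib enclosures `0.6931471803 < log 2` (`Real.log_two_gt_d9`) and `1/2 < γ`
(`Real.one_half_lt_eulerMascheroniConstant`):

* every term `(log 2)^(n+1) / ((n+1) · (n+1)!)` is nonnegative and the series is summable
  (`summable_logIntegralSeriesTerm`, in `LogIntegralProofs`), so the sum is at least its first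
  term `log 2` (`log_le_tsum_logIntegralSeriesTerm`);
* `log 2 > 1/2`, hence `log (log 2) > log (1/2) = -log 2`;
* therefore `li 2 ≥ γ + log (log 2) + log 2 > γ > 1/2 > 0`.

(The sharper enclosure `li 2 ∈ (1.045, 1.046)` is not needed by any dependent and is not
proved here.)

## References

* L. Schoenfeld, *Sharper bounds for the Chebyshev functions θ(x) and ψ(x). II*,
  Math. Comp. 30 (1976), 337–360, doi:10.2307/2005976. [cite: Schoenfeld1976]
* M. Abramowitz, I. A. Stegun (eds.), *Handbook of Mathematical Functions*, NBS AMS 55, 1964,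
  §5.1 (5.1.3, 5.1.10, Table 5.1). [cite: AbramowitzStegun1964]
-/

noncomputable section

open Real
open scoped Nat

namespace Literature.NumberTheory.LFunctions

section LogIntegralTwoPos

/-- The general term `(log x)^(n+1) / ((n+1) · (n+1)!)` of Ramanujan's series is nonnegative as
soon as `x ≥ 1`. [folklore] -/
theorem logIntegralSeriesTerm_nonneg {x : ℝ} (hx : 1 ≤ x) (n : ℕ) :
    0 ≤ logIntegralSeriesTerm x n := by
  unfold logIntegralSeriesTerm
  have := Real.log_nonneg hx
  positivity

/-- The first term of Ramanujan's series bounds it from below for `x ≥ 1`: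
`log x ≤ ∑_{n ≥ 1} (log x)^n / (n · n!)` (nonnegative terms, summable series). [folklore] -/
theorem log_le_tsum_logIntegralSeriesTerm {x : ℝ} (hx : 1 ≤ x) :
    Real.log x ≤ ∑' n, logIntegralSeriesTerm x n := by
  have h0 : logIntegralSeriesTerm x 0 = Real.log x := by
    simp [logIntegralSeriesTerm]
  rw [← h0]
  exact (summable_logIntegralSeriesTerm x).le_tsum 0
    (fun j _ => logIntegralSeriesTerm_nonneg hx j)

/-- A crude but sufficient lower bound: `γ ≤ li 2` (indeed `li 2 ≥ γ + log log 2 + log 2` and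
`log log 2 > -log 2` because `log 2 > 1/2`). [folklore] -/
theorem eulerMascheroniConstant_lt_logIntegral_two :
    Real.eulerMascheroniConstant < logIntegral 2 := by
  unfold logIntegral
  have hlog2 : (1 / 2 : ℝ) < Real.log 2 := by
    have := Real.log_two_gt_d9
    linarith
  have hloglog : -Real.log 2 < Real.log (Real.log 2) := by
    have h := Real.log_lt_log (by norm_num : (0 : ℝ) < 1 / 2) hlog2
    rwa [one_div, Real.log_inv] at h
  have hser : Real.log 2 ≤ ∑' n, logIntegralSeriesTerm 2 n :=
    log_le_tsum_logIntegralSeriesTerm (by norm_num)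
  linarith

/-- **Discharge of `Literature.NumberTheory.LFunctions.logIntegral_two_pos`**: `li 2 > 0`.
From `li 2 > γ` (`eulerMascheroniConstant_lt_logIntegral_two`) and `γ > 1/2`
(`Real.one_half_lt_eulerMascheroniConstant`). Numerically `li 2 = 1.04516…`
(Abramowitz–Stegun, Table 5.1); Schoenfeld 1976 uses `li 2 ≈ 1.0452`.
[cite: Schoenfeld1976, uses  li 2 ≈ 1.0452] -/
theorem logIntegral_two_pos_holds : logIntegral_two_pos := by
  unfold logIntegral_two_pos
  have hγ : (1 / 2 : ℝ) < Real.eulerMascheroniConstant :=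
    Real.one_half_lt_eulerMascheroniConstant
  have h := eulerMascheroniConstant_lt_logIntegral_two
  linarith

end LogIntegralTwoPos

end Literature.NumberTheory.LFunctions
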